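import Summits.FinalStateConjecture.FinalStateConjecture.Statement
import Summits.FinalStateConjecture.FinalStateConjecture.Theorems.PhaseMixingCaptureCaptureSufficesC2SettlingTransport
import Literature.Geometry.Lorentzian.TameBreathingCurve
import Literature.Geometry.Lorentzian.CauchyDevelopmentPrecomp
import Literature.Geometry.Lorentzian.AFEndUnbreathe
import Literature.Geometry.Lorentzian.TameGenericityLocal
import Literature.Geometry.Lorentzian.FinalState
import HarnessLib

/-!
# `HonestFixedRadiusSettlingT` (stmt-FinalStateConjecture-17575), line `Sketch`: the RAYS-LESS
# per-datum property is invariant under re-indexing the data, has tame SELF-WITNESSES (breathing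
# curves), and local kicks at exceptional data suffice for the dynamical stub

The crux `T` is tame Christodoulou genericity of `P_T D` = "an MGHD exists, and every MGHD has
complete `𝓘⁺` and admits `(O, d, R₀)`, an honest `C⁴` `FinalStateDecomposition` of
`O = exteriorOf 𝒟 d.charted` with `RaysStayInClosure`, HonestCore, HonestFar and pairwise distinct
hole velocities". The line's lever (p134843) removes the rays clause; the remaining RAYS-LESS
property `Pnr D` (verbatim the let-bound `Hc`/`Hf` of the route text, `k = 4`) is what the line's
dynamical stub `stub_coreAlongClean` must produce along curves. This file transports `Pnr` along
the re-indexing `D ↦ Φ^* D` of the data by a diffeomorphism `Φ` of `X`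
(`VacuumCauchyDevelopment.precomp`, `Literature/Geometry/Lorentzian/CauchyDevelopmentPrecomp.lean`:
same spacetime, embedding `ι ∘ Φ`; the pattern of
`Theorems/PhaseMixingCaptureCaptureSufficesC2SettlingTransport.lean` for the `C²` summit clause),
and draws the two consequences the skeleton consumes:

* `rayless_precomp_iff`, `raylessClause_comap_iff` — `Pnr` read on `precomp 𝒟 Φ` iff on `𝒟`
  (the decomposition, `Hc`, `Hf` and the velocity clause see the spacetime only; `exteriorOf` sees
  `range ι`, unchanged; complete `𝓘⁺` by `hasCompleteFutureNullInfinity_precomp_iff`), hence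
  `Pnr (Φ^* D) ↔ Pnr D` over all maximal developments (`forall_isMaximal_comap_iff`);
* `rayless_breatheFamily`, `raylessSelfWitness` — `Pnr` passes to every member of the breathing
  family of `d` (`AFEnd.breatheFamily`, isometric copies), so through every ADMISSIBLE datum with
  `Pnr` passes a tame (collared sole end), injective, immersed curve of admissible data ALL having
  `Pnr` (`TameBreathingCurve.lean`);
* `raylessCurveWitness_of_local` — consequently the conclusion of the dynamical stub at a base datum
  `d` (a tame injective immersed admissible curve through `d` whose members off `0` have `Pnr`)
  follows from a LOCAL kick at `d` WHEN `d` IS EXCEPTIONAL (members with `0 < ‖c‖ < ε₀` have `Pnr`;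
  radial reparametrisation `InitialDataSet.exists_tameCurve_of_local`) — and from nothing at all
  when `Pnr d` holds. The "strong form" of the stub (a punctured `Pnr`-curve through EVERY datum) is
  therefore not stronger than Christodoulou's exceptional-datum form.

No definitions, no named facts, no `sorry`; Theses-free (importable by a closing file).
-/

set_option linter.dupNamespace false

noncomputable section

open Set Function Filter
open scoped Manifold ContDiff Topology

namespace Summit.FinalStateConjecture.FinalStateConjecture.Theorems.StarvedNecks.RaylessTransport

open Literature.Geometry.Lorentzian
open Summit.FinalStateConjecture (HasCompleteNullInfinity exteriorOf)
open Summit.FinalStateConjecture.FinalStateConjecture.Theorems.PhaseMixingCaptureCaptureSufficesC2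
  (exteriorOf_precomp injective_mfderiv_homeomorph_symm)

/-- **`Pnr` of the re-indexed development iff of the original.** For a vacuum Cauchy development `𝒟`
of `D` and a diffeomorphism `Φ` of `X`, the rays-less clause (complete `𝓘⁺`; an honest `C⁴`
decomposition `(O, dd, R₀)` of `O = exteriorOf` with `Hc`, `Hf`, distinct velocities) holds for
`precomp 𝒟 Φ` iff for `𝒟`: same spacetime, `range (ι ∘ Φ) = range ι`. Registered helper stub of
stmt-FinalStateConjecture-17575 (closed one-line signature). [cite: ChoquetBruhatGeroch1969CMP, p. 330] -/
theorem rayless_precomp_iff : open Literature.Geometry.Lorentzian in open scoped ContDiff in let Hc := ( fun (𝓢 : Spacetime.{0} 4) (O : Set 𝓢.carrier) (k : ℕ) (d : FinalStateDecomposition 𝓢 O k) (R₀ : ℝ) => let B := d.background; let t := fun i ↦ (B i).time; let r := fun i ↦ (B i).radius; let Ψ := d.chart; (∀ i, Kerr.IsSubextremal (d.mass i) (d.spin i) ∧ 100 * d.mass i ≤ R₀ ∧ 0 < ((d.motion i).1 : E4 ≃L[ℝ] E4) (E4.basisVector 0) 0) ∧ (∀ i (ϱ τ₂ : ℝ), R₀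 ≤ ϱ → d.τ₀ < τ₂ → Ψ i '' {x | d.τ₀ < t i x.1 ∧ t i x.1 < τ₂ ∧ r i x.1 < ϱ} ⊆ 𝓢.metric.causalPast 𝓢.timeOrientation (Ψ i '' (B i).truncTimeSlab ϱ τ₂)) ∧ (∀ i (τ' : ℝ) (ϱ : ℝ → ℝ), Continuous ϱ → d.τ₀ < τ' → let A := Ψ i '' {x | τ' ≤ t i x.1 ∧ r i x.1 ≤ ϱ (t i x.1)}; closure A ∩ O ⊆ A) ∧ (∀ y : d.flatDomain, d.τ₀ < y.1 0 → 𝓢.timeOrientation.IsFutureDirected (mfderiv 𝓘(ℝ, E4) (𝓡 4) d.flatChart y (E4.basisVector 0))) ); let Hf := ( fun (𝓢 : Spacetime.{0} 4) (O : Set 𝓢.carrier) (k : ℕ) (d : FinalStateDecomposition 𝓢 O k) (R₀ : ℝ) => let B := d.background; let t := fun i ↦ (B i).time; let r := fun i ↦ (B i).radius; let Φ := d.flatChart; (∀ τ₂ : ℝ, d.τ₀ < τ₂ → Φ '' {y | d.τ₀ < y.1 0 ∧ y.1 0 < τ₂} ⊆ 𝓢.metric.causalPast 𝓢.timeOrientation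 (Φ '' (Minkowski.backgroundOn d.flatDomain).timeSlab τ₂)) ∧ (∀ τ' : ℝ, d.τ₀ < τ' → closure (Φ '' {y | τ' ≤ y.1 0 ∧ ∀ i, d.excision i (y.1 0) + 1 ≤ r i y.1}) ⊆ Φ '' {y | τ' ≤ y.1 0}) ∧ (∀ i, ∃ T : ℝ, supCkENorm (Subtype.val '' {x : (B i).domain | T ≤ t i x.1 ∧ R₀ ≤ r i x.1 ∧ ∀ j, j ≠ i → r i x.1 ≤ r j x.1}) 0 (𝓢.deviationExtend (B i) (d.chart i)) ≤ ENNReal.ofReal (1 / (10 * ‖(((d.motion i).1 : E4 ≃L[ℝ] E4) : E4 →L[ℝ] E4)‖ ^ 2))) ); ∀ {X : Type} [TopologicalSpace X] [ChartedSpace E3 X] [IsManifold (𝓡 3) ∞ X] [ConnectedSpace X] {D : InitialDataSet (𝓡 3) X} (𝒟 : VacuumCauchyDevelopment D) (Φ : X ≃ₜ X) (hΦ : ContMDiff (𝓡 3) (𝓡 3) (∞ + 1) Φ) (hΦ' : ∀ u, Function.Injective (mfderiv (𝓡 3) (𝓡 3) Φ u)), (HasCompleteNullInfinity (𝒟.precomp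 Φ hΦ hΦ').toCauchyDevelopment ∧ ∃ (O : Set (𝒟.precomp Φ hΦ hΦ').carrier) (dd : FinalStateDecomposition (𝒟.precomp Φ hΦ hΦ').toSpacetime O 4) (R₀ : ℝ), O = exteriorOf (𝒟.precomp Φ hΦ hΦ').toCauchyDevelopment dd.charted ∧ Hc (𝒟.precomp Φ hΦ hΦ').toSpacetime O 4 dd R₀ ∧ Hf (𝒟.precomp Φ hΦ hΦ').toSpacetime O 4 dd R₀ ∧ (∀ i j : Fin dd.N, i ≠ j → ((dd.motion i).1 : E4 ≃L[ℝ] E4) (E4.basisVector 0) ≠ ((dd.motion j).1 : E4 ≃L[ℝ] E4) (E4.basisVector 0))) ↔ (HasCompleteNullInfinity 𝒟.toCauchyDevelopment ∧ ∃ (O : Set 𝒟.carrier) (dd : FinalStateDecomposition 𝒟.toSpacetime O 4) (R₀ : ℝ), O = exteriorOf 𝒟.toCauchyDevelopment dd.charted ∧ Hc 𝒟.toSpacetime O 4 dd R₀ ∧ Hf 𝒟.toSpacetime O 4 dd R₀ ∧ (∀ i j : Fin dd.N, i ≠ j → ((dd.motion i).1 : E4 ≃L[ℝ] E4) (E4.basisVector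 0) ≠ ((dd.motion j).1 : E4 ≃L[ℝ] E4) (E4.basisVector 0))) := by
  intro Hc Hf X _ _ _ _ D 𝒟 Φ hΦ hΦ'
  refine and_congr (𝒟.hasCompleteFutureNullInfinity_precomp_iff Φ hΦ hΦ') ?_
  constructor
  · rintro ⟨O, dd, R₀, hO, hc, hf, hv⟩
    refine ⟨O, dd, R₀, ?_, hc, hf, hv⟩
    rwa [exteriorOf_precomp] at hO
  · rintro ⟨O, dd, R₀, hO, hc, hf, hv⟩
    refine ⟨O, dd, R₀, ?_, hc, hf, hv⟩
    rwa [exteriorOf_precomp]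

/-- **The rays-less per-datum property is invariant under re-indexing the data**: "`Φ^* D` has an
MGHD and every MGHD of `Φ^* D` satisfies the rays-less clause" iff the same for `D` (`Φ` a
diffeomorphism: homeomorphism, smooth with injective differentials both ways). Registered helper stub
of stmt-FinalStateConjecture-17575. [cite: ChoquetBruhatGeroch1969CMP, p. 330] -/
theorem raylessClause_comap_iff : open Literature.Geometry.Lorentzian in open scoped ContDiff in let Hc := ( fun (𝓢 : Spacetime.{0} 4) (O : Set 𝓢.carrier) (k : ℕ) (d : FinalStateDecomposition 𝓢 O k) (R₀ : ℝ) => let B := d.background; let t := fun i ↦ (B i).time; let r := fun i ↦ (B i).radius; let Ψ := d.chart; (∀ i, Kerr.IsSubextremal (d.mass i) (d.spin i) ∧ 100 * d.mass i ≤ R₀ ∧ 0 < ((d.motion i).1 : E4 ≃L[ℝ] E4) (E4.basisVector 0) 0) ∧ (∀ i (ϱ τ₂ : ℝ), R₀ ≤ ϱ → d.τ₀ < τ₂ → Ψ i '' {x | d.τ₀ < t i x.1 ∧ t i x.1 < τ₂ ∧ r i x.1 < ϱ} ⊆ 𝓢.metric.causalPast 𝓢.timeOrientation (Ψ i '' (B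 i).truncTimeSlab ϱ τ₂)) ∧ (∀ i (τ' : ℝ) (ϱ : ℝ → ℝ), Continuous ϱ → d.τ₀ < τ' → let A := Ψ i '' {x | τ' ≤ t i x.1 ∧ r i x.1 ≤ ϱ (t i x.1)}; closure A ∩ O ⊆ A) ∧ (∀ y : d.flatDomain, d.τ₀ < y.1 0 → 𝓢.timeOrientation.IsFutureDirected (mfderiv 𝓘(ℝ, E4) (𝓡 4) d.flatChart y (E4.basisVector 0))) ); let Hf := ( fun (𝓢 : Spacetime.{0} 4) (O : Set 𝓢.carrier) (k : ℕ) (d : FinalStateDecomposition 𝓢 O k) (R₀ : ℝ) => let B := d.background; let t := fun i ↦ (B i).time; let r := fun i ↦ (B i).radius; let Φ := d.flatChart; (∀ τ₂ : ℝ, d.τ₀ < τ₂ → Φ '' {y | d.τ₀ < y.1 0 ∧ y.1 0 < τ₂} ⊆ 𝓢.metric.causalPast 𝓢.timeOrientation (Φ '' (Minkowski.backgroundOn d.flatDomain).timeSlab τ₂)) ∧ (∀ τ' : ℝ, d.τ₀ < τ' → closure (Φ '' {y | τ' ≤ y.1 0 ∧ ∀ i, d.excision i (y.1 0) + 1 ≤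 r i y.1}) ⊆ Φ '' {y | τ' ≤ y.1 0}) ∧ (∀ i, ∃ T : ℝ, supCkENorm (Subtype.val '' {x : (B i).domain | T ≤ t i x.1 ∧ R₀ ≤ r i x.1 ∧ ∀ j, j ≠ i → r i x.1 ≤ r j x.1}) 0 (𝓢.deviationExtend (B i) (d.chart i)) ≤ ENNReal.ofReal (1 / (10 * ‖(((d.motion i).1 : E4 ≃L[ℝ] E4) : E4 →L[ℝ] E4)‖ ^ 2))) ); ∀ {X : Type} [TopologicalSpace X] [ChartedSpace E3 X] [IsManifold (𝓡 3) ∞ X] [ConnectedSpace X] {D : InitialDataSet (𝓡 3) X} (Φ : X ≃ₜ X) (hΦ : ContMDiff (𝓡 3) (𝓡 3) (∞ + 1) Φ) (hΦ' : ∀ u, Function.Injective (mfderiv (𝓡 3) (𝓡 3) Φ u)), ContMDiff (𝓡 3) (𝓡 3) (∞ + 1) Φ.symm → (∀ u, Function.Injective (mfderiv (𝓡 3) (𝓡 3) Φ.symm u)) → (((∃ 𝒟 : VacuumCauchyDevelopment (D.comap Φ hΦ hΦ'), 𝒟.IsMaximal) ∧ ∀ 𝒟 : VacuumCauchyDevelopment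 (D.comap Φ hΦ hΦ'), 𝒟.IsMaximal → (HasCompleteNullInfinity 𝒟.toCauchyDevelopment ∧ ∃ (O : Set 𝒟.carrier) (dd : FinalStateDecomposition 𝒟.toSpacetime O 4) (R₀ : ℝ), O = exteriorOf 𝒟.toCauchyDevelopment dd.charted ∧ Hc 𝒟.toSpacetime O 4 dd R₀ ∧ Hf 𝒟.toSpacetime O 4 dd R₀ ∧ (∀ i j : Fin dd.N, i ≠ j → ((dd.motion i).1 : E4 ≃L[ℝ] E4) (E4.basisVector 0) ≠ ((dd.motion j).1 : E4 ≃L[ℝ] E4) (E4.basisVector 0)))) ↔ ((∃ 𝒟 : VacuumCauchyDevelopment (D), 𝒟.IsMaximal) ∧ ∀ 𝒟 : VacuumCauchyDevelopment (D), 𝒟.IsMaximal → (HasCompleteNullInfinity 𝒟.toCauchyDevelopment ∧ ∃ (O : Set 𝒟.carrier) (dd : FinalStateDecomposition 𝒟.toSpacetime O 4) (R₀ : ℝ), O = exteriorOf 𝒟.toCauchyDevelopment dd.charted ∧ Hc 𝒟.toSpacetime O 4 dd R₀ ∧ Hf 𝒟.toSpacetime O 4 dd R₀ ∧ (∀ i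 j : Fin dd.N, i ≠ j → ((dd.motion i).1 : E4 ≃L[ℝ] E4) (E4.basisVector 0) ≠ ((dd.motion j).1 : E4 ≃L[ℝ] E4) (E4.basisVector 0))))) := by
  intro Hc Hf X _ _ _ _ D Φ hΦ hΦ' hΨ hΨ'
  refine and_congr (VacuumCauchyDevelopment.exists_isMaximal_comap_iff Φ hΦ hΦ' hΨ hΨ') ?_
  exact VacuumCauchyDevelopment.forall_isMaximal_comap_iff Φ hΦ hΦ' hΨ hΨ'
    (fun {D'} (𝒟 : VacuumCauchyDevelopment D') ↦ (HasCompleteNullInfinity 𝒟.toCauchyDevelopment ∧ ∃ (O : Set 𝒟.carrier) (dd : FinalStateDecomposition 𝒟.toSpacetime O 4) (R₀ : ℝ), O = exteriorOf 𝒟.toCauchyDevelopment dd.charted ∧ Hc 𝒟.toSpacetime O 4 dd R₀ ∧ Hf 𝒟.toSpacetime O 4 dd R₀ ∧ (∀ i j : Fin dd.N, i ≠ j → ((dd.motion i).1 : E4 ≃L[ℝ] E4) (E4.basisVector 0) ≠ ((dd.motion j).1 : E4 ≃L[ℝ] E4) (E4.basisVector 0))))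
    fun 𝒟 Θ hΘ hΘ' ↦ rayless_precomp_iff 𝒟 Θ hΘ hΘ'

/-- **`Pnr` passes from `d` to every member of its breathing family** (`E_t = (breathe (σ t))^* d`,
transferred by `raylessClause_comap_iff`). Registered helper stub of stmt-FinalStateConjecture-17575.
[cite: BartnikIsenberg2004, §2] -/
theorem rayless_breatheFamily : open Literature.Geometry.Lorentzian in open scoped ContDiff in let Hc := ( fun (𝓢 : Spacetime.{0} 4) (O : Set 𝓢.carrier) (k : ℕ) (d : FinalStateDecomposition 𝓢 O k) (R₀ : ℝ) => let B := d.background; let t := fun i ↦ (B i).time; let r := fun i ↦ (B i).radius; let Ψ := d.chart; (∀ i, Kerr.IsSubextremal (d.mass i) (d.spin i) ∧ 100 * d.mass i ≤ R₀ ∧ 0 < ((d.motion i).1 : E4 ≃L[ℝ] E4) (E4.basisVector 0) 0) ∧ (∀ i (ϱ τ₂ : ℝ), R₀ ≤ ϱ → d.τ₀ < τ₂ → Ψ i '' {x | d.τ₀ < t i x.1 ∧ t i x.1 < τ₂ ∧ r i x.1 < ϱ} ⊆ 𝓢.metric.causalPast 𝓢.timeOrientation (Ψ i '' (B i).truncTimeSlab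 ϱ τ₂)) ∧ (∀ i (τ' : ℝ) (ϱ : ℝ → ℝ), Continuous ϱ → d.τ₀ < τ' → let A := Ψ i '' {x | τ' ≤ t i x.1 ∧ r i x.1 ≤ ϱ (t i x.1)}; closure A ∩ O ⊆ A) ∧ (∀ y : d.flatDomain, d.τ₀ < y.1 0 → 𝓢.timeOrientation.IsFutureDirected (mfderiv 𝓘(ℝ, E4) (𝓡 4) d.flatChart y (E4.basisVector 0))) ); let Hf := ( fun (𝓢 : Spacetime.{0} 4) (O : Set 𝓢.carrier) (k : ℕ) (d : FinalStateDecomposition 𝓢 O k) (R₀ : ℝ) => let B := d.background; let t := fun i ↦ (B i).time; let r := fun i ↦ (B i).radius; let Φ := d.flatChart; (∀ τ₂ : ℝ, d.τ₀ < τ₂ → Φ '' {y | d.τ₀ < y.1 0 ∧ y.1 0 < τ₂} ⊆ 𝓢.metric.causalPast 𝓢.timeOrientation (Φ '' (Minkowski.backgroundOn d.flatDomain).timeSlab τ₂)) ∧ (∀ τ' : ℝ, d.τ₀ < τ' → closure (Φ '' {y | τ' ≤ y.1 0 ∧ ∀ i, d.excision i (y.1 0) + 1 ≤ r i y.1}) ⊆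 Φ '' {y | τ' ≤ y.1 0}) ∧ (∀ i, ∃ T : ℝ, supCkENorm (Subtype.val '' {x : (B i).domain | T ≤ t i x.1 ∧ R₀ ≤ r i x.1 ∧ ∀ j, j ≠ i → r i x.1 ≤ r j x.1}) 0 (𝓢.deviationExtend (B i) (d.chart i)) ≤ ENNReal.ofReal (1 / (10 * ‖(((d.motion i).1 : E4 ≃L[ℝ] E4) : E4 →L[ℝ] E4)‖ ^ 2))) ); ∀ {X : Type} [TopologicalSpace X] [ChartedSpace E3 X] [IsManifold (𝓡 3) ∞ X] [T2Space X] [ConnectedSpace X] {e : AFEnd X} {z₀ : E3} {r : ℝ} (B : AFEnd.BreathingData e z₀ r) (d : InitialDataSet (𝓡 3) X) (t : ℝ), ((∃ 𝒟 : VacuumCauchyDevelopment (d), 𝒟.IsMaximal) ∧ ∀ 𝒟 : VacuumCauchyDevelopment (d), 𝒟.IsMaximal → (HasCompleteNullInfinity 𝒟.toCauchyDevelopment ∧ ∃ (O : Set 𝒟.carrier) (dd : FinalStateDecomposition 𝒟.toSpacetime O 4) (R₀ : ℝ), O = exteriorOf 𝒟.toCauchyDevelopment dd.charted ∧ Hc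 𝒟.toSpacetime O 4 dd R₀ ∧ Hf 𝒟.toSpacetime O 4 dd R₀ ∧ (∀ i j : Fin dd.N, i ≠ j → ((dd.motion i).1 : E4 ≃L[ℝ] E4) (E4.basisVector 0) ≠ ((dd.motion j).1 : E4 ≃L[ℝ] E4) (E4.basisVector 0)))) → ((∃ 𝒟 : VacuumCauchyDevelopment (AFEnd.breatheFamily B d t), 𝒟.IsMaximal) ∧ ∀ 𝒟 : VacuumCauchyDevelopment (AFEnd.breatheFamily B d t), 𝒟.IsMaximal → (HasCompleteNullInfinity 𝒟.toCauchyDevelopment ∧ ∃ (O : Set 𝒟.carrier) (dd : FinalStateDecomposition 𝒟.toSpacetime O 4) (R₀ : ℝ), O = exteriorOf 𝒟.toCauchyDevelopment dd.charted ∧ Hc 𝒟.toSpacetime O 4 dd R₀ ∧ Hf 𝒟.toSpacetime O 4 dd R₀ ∧ (∀ i j : Fin dd.N, i ≠ j → ((dd.motion i).1 : E4 ≃L[ℝ] E4) (E4.basisVector 0) ≠ ((dd.motion j).1 : E4 ≃L[ℝ] E4) (E4.basisVector 0)))) := by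
  intro Hc Hf X _ _ _ _ _ e z₀ r B d t hP
  set Φ : X ≃ₜ X := AFEnd.breatheHomeomorph B (AFEnd.abs_squash_lt_invScale B t) with hΦdef
  have hΦ : ContMDiff (𝓡 3) (𝓡 3) (∞ + 1) Φ :=
    AFEnd.contMDiff_breathe_succ B (AFEnd.abs_squash_lt_scale B t).2
  have hΦ' : ∀ u, Injective (mfderiv (𝓡 3) (𝓡 3) Φ u) :=
    (AFEnd.breatheScale_spec B).2.2 _ (AFEnd.abs_squash_lt_scale B t).1
  have hΨ : ContMDiff (𝓡 3) (𝓡 3) (∞ + 1) Φ.symm := AFEnd.contMDiff_unbreathe B _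
  have hΨ' : ∀ u, Injective (mfderiv (𝓡 3) (𝓡 3) Φ.symm u) :=
    injective_mfderiv_homeomorph_symm Φ hΦ hΨ
  have key : AFEnd.breatheFamily B d t = d.comap Φ hΦ hΦ' := rfl
  rw [key]
  exact (raylessClause_comap_iff Φ hΦ hΦ' hΨ hΨ').2 hP

/-- **SELF-WITNESSES OF THE RAYS-LESS PROPERTY.** Through every admissible datum `d` with `Pnr d`
passes a tame (on a collared restriction of a sole end of `d`), injective, immersed curve of admissible
data all having `Pnr`: the breathing curve of `d`. Registered helper stub of stmt-FinalStateConjecture-17575.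
[cite: Christodoulou1999, p. A24] -/
theorem raylessSelfWitness : open Literature.Geometry.Lorentzian in open scoped ContDiff in let Hc := ( fun (𝓢 : Spacetime.{0} 4) (O : Set 𝓢.carrier) (k : ℕ) (d : FinalStateDecomposition 𝓢 O k) (R₀ : ℝ) => let B := d.background; let t := fun i ↦ (B i).time; let r := fun i ↦ (B i).radius; let Ψ := d.chart; (∀ i, Kerr.IsSubextremal (d.mass i) (d.spin i) ∧ 100 * d.mass i ≤ R₀ ∧ 0 < ((d.motion i).1 : E4 ≃L[ℝ] E4) (E4.basisVector 0) 0) ∧ (∀ i (ϱ τ₂ : ℝ), R₀ ≤ ϱ → d.τ₀ < τ₂ → Ψ i '' {x | d.τ₀ < t i x.1 ∧ t i x.1 < τ₂ ∧ r i x.1 < ϱ} ⊆ 𝓢.metric.causalPast 𝓢.timeOrientation (Ψ i '' (B i).truncTimeSlab ϱ τ₂)) ∧ (∀ i (τ' : ℝ) (ϱ : ℝ → ℝ), Continuous ϱ → d.τ₀ < τ' → let A := Ψ i '' {x | τ' ≤ t i x.1 ∧ r i x.1 ≤ ϱ (t i x.1)}; closure A ∩ O ⊆ A) ∧ (∀ y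 : d.flatDomain, d.τ₀ < y.1 0 → 𝓢.timeOrientation.IsFutureDirected (mfderiv 𝓘(ℝ, E4) (𝓡 4) d.flatChart y (E4.basisVector 0))) ); let Hf := ( fun (𝓢 : Spacetime.{0} 4) (O : Set 𝓢.carrier) (k : ℕ) (d : FinalStateDecomposition 𝓢 O k) (R₀ : ℝ) => let B := d.background; let t := fun i ↦ (B i).time; let r := fun i ↦ (B i).radius; let Φ := d.flatChart; (∀ τ₂ : ℝ, d.τ₀ < τ₂ → Φ '' {y | d.τ₀ < y.1 0 ∧ y.1 0 < τ₂} ⊆ 𝓢.metric.causalPast 𝓢.timeOrientation (Φ '' (Minkowski.backgroundOn d.flatDomain).timeSlab τ₂)) ∧ (∀ τ' : ℝ, d.τ₀ < τ' → closure (Φ '' {y | τ' ≤ y.1 0 ∧ ∀ i, d.excision i (y.1 0) + 1 ≤ r i y.1}) ⊆ Φ '' {y | τ' ≤ y.1 0}) ∧ (∀ i, ∃ T : ℝ, supCkENorm (Subtype.val '' {x : (B i).domain | T ≤ t i x.1 ∧ R₀ ≤ r i x.1 ∧ ∀ j, j ≠ i → r i x.1 ≤ r j x.1}) 0 (𝓢.deviationExtend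 (B i) (d.chart i)) ≤ ENNReal.ofReal (1 / (10 * ‖(((d.motion i).1 : E4 ≃L[ℝ] E4) : E4 →L[ℝ] E4)‖ ^ 2))) ); ∀ (X : Type) [TopologicalSpace X] [ChartedSpace E3 X] [IsManifold (𝓡 3) ∞ X] [T2Space X] [SecondCountableTopology X] [ConnectedSpace X] (d : InitialDataSet (𝓡 3) X), d ∈ admissibleVacuumData X → ((∃ 𝒟 : VacuumCauchyDevelopment (d), 𝒟.IsMaximal) ∧ ∀ 𝒟 : VacuumCauchyDevelopment (d), 𝒟.IsMaximal → (HasCompleteNullInfinity 𝒟.toCauchyDevelopment ∧ ∃ (O : Set 𝒟.carrier) (dd : FinalStateDecomposition 𝒟.toSpacetime O 4) (R₀ : ℝ), O = exteriorOf 𝒟.toCauchyDevelopment dd.charted ∧ Hc 𝒟.toSpacetime O 4 dd R₀ ∧ Hf 𝒟.toSpacetime O 4 dd R₀ ∧ (∀ i j : Fin dd.N, i ≠ j → ((dd.motion i).1 : E4 ≃L[ℝ] E4) (E4.basisVector 0) ≠ ((dd.motion j).1 : E4 ≃L[ℝ] E4) (E4.basisVector 0)))) → ∃ (e' : AFEnd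 X) (F' : EuclideanSpace ℝ (Fin 1) → InitialDataSet (𝓡 3) X), InitialDataSet.IsTameDataFamily e' 1 F' ∧ F' 0 = d ∧ Function.Injective F' ∧ InitialDataSet.IsImmersedAtZero 1 F' ∧ (∀ c, F' c ∈ admissibleVacuumData X) ∧ ∀ c : EuclideanSpace ℝ (Fin 1), c ≠ 0 → ((∃ 𝒟 : VacuumCauchyDevelopment (F' c), 𝒟.IsMaximal) ∧ ∀ 𝒟 : VacuumCauchyDevelopment (F' c), 𝒟.IsMaximal → (HasCompleteNullInfinity 𝒟.toCauchyDevelopment ∧ ∃ (O : Set 𝒟.carrier) (dd : FinalStateDecomposition 𝒟.toSpacetime O 4) (R₀ : ℝ), O = exteriorOf 𝒟.toCauchyDevelopment dd.charted ∧ Hc 𝒟.toSpacetime O 4 dd R₀ ∧ Hf 𝒟.toSpacetime O 4 dd R₀ ∧ (∀ i j : Fin dd.N, i ≠ j → ((dd.motion i).1 : E4 ≃L[ℝ] E4) (E4.basisVector 0) ≠ ((dd.motion j).1 : E4 ≃L[ℝ] E4) (E4.basisVector 0)))) := by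
  intro Hc Hf X _ _ _ _ _ _ d hd hP
  obtain ⟨-, e₀, M, hsole, hdecay⟩ := id hd
  set z₀ : E3 := (e₀.R + 3) • EuclideanSpace.single (0 : Fin 3) (1 : ℝ) with hz₀
  have hz₀n : ‖z₀‖ = e₀.R + 3 := by
    rw [hz₀, norm_smul, PiLp.norm_single, norm_one, mul_one,
      Real.norm_of_nonneg (by linarith [e₀.R_pos])]
  have B : e₀.BreathingData z₀ 1 := ⟨one_pos, by rw [hz₀n]; linarith⟩
  have hR₁ : e₀.R < e₀.R + 1 := by linarith
  exact ⟨e₀.restrict hR₁.le, fun c ↦ AFEnd.breatheFamily B d (c 0),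
    AFEnd.isTameDataFamily_restrict_breatheCurve B d hsole hdecay hR₁,
    AFEnd.breatheCurve_zero B d, AFEnd.injective_breatheCurve B d,
    AFEnd.isImmersedAtZero_breatheCurve B d,
    fun c ↦ AFEnd.breatheCurve_mem_admissibleVacuumData B d hd c,
    fun c _ ↦ rayless_breatheFamily B d (c 0) hP⟩

/-- **LOCAL KICKS AT EXCEPTIONAL DATA SUFFICE.** Let `d` be admissible. If, in case `d` is
exceptional (`¬ Pnr d`), some tame injective immersed curve of admissible data through `d` has `Pnr`
at every member with `0 < ‖c‖ < ε₀`, then through `d` passes a tame injective immersed curve of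
admissible data whose members off `0` ALL have `Pnr` — by the self-witness when `Pnr d`, and by the
radial reparametrisation `InitialDataSet.exists_tameCurve_of_local` of the kick otherwise. This is the
conclusion shape of the line's dynamical stub. Registered helper stub of stmt-FinalStateConjecture-17575.
[cite: Christodoulou1999, p. A24] -/
theorem raylessCurveWitness_of_local : open Literature.Geometry.Lorentzian in open scoped ContDiff in let Hc := ( fun (𝓢 : Spacetime.{0} 4) (O : Set 𝓢.carrier) (k : ℕ) (d : FinalStateDecomposition 𝓢 O k) (R₀ : ℝ) => let B := d.background; let t := fun i ↦ (B i).time; let r := fun i ↦ (B i).radius; let Ψ := d.chart; (∀ i, Kerr.IsSubextremal (d.mass i) (d.spin i) ∧ 100 * d.mass i ≤ R₀ ∧ 0 < ((d.motion i).1 : E4 ≃L[ℝ] E4) (E4.basisVector 0) 0) ∧ (∀ i (ϱ τ₂ : ℝ), R₀ ≤ ϱ → d.τ₀ < τ₂ → Ψ i '' {x | d.τ₀ < t i x.1 ∧ t i x.1 < τ₂ ∧ r i x.1 < ϱ} ⊆ 𝓢.metric.causalPast 𝓢.timeOrientation (Ψ i '' (B i).truncTimeSlab ϱ τ₂)) ∧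 (∀ i (τ' : ℝ) (ϱ : ℝ → ℝ), Continuous ϱ → d.τ₀ < τ' → let A := Ψ i '' {x | τ' ≤ t i x.1 ∧ r i x.1 ≤ ϱ (t i x.1)}; closure A ∩ O ⊆ A) ∧ (∀ y : d.flatDomain, d.τ₀ < y.1 0 → 𝓢.timeOrientation.IsFutureDirected (mfderiv 𝓘(ℝ, E4) (𝓡 4) d.flatChart y (E4.basisVector 0))) ); let Hf := ( fun (𝓢 : Spacetime.{0} 4) (O : Set 𝓢.carrier) (k : ℕ) (d : FinalStateDecomposition 𝓢 O k) (R₀ : ℝ) => let B := d.background; let t := fun i ↦ (B i).time; let r := fun i ↦ (B i).radius; let Φ := d.flatChart; (∀ τ₂ : ℝ, d.τ₀ < τ₂ → Φ '' {y | d.τ₀ < y.1 0 ∧ y.1 0 < τ₂} ⊆ 𝓢.metric.causalPast 𝓢.timeOrientation (Φ '' (Minkowski.backgroundOn d.flatDomain).timeSlab τ₂)) ∧ (∀ τ' : ℝ, d.τ₀ < τ' → closure (Φ '' {y | τ' ≤ y.1 0 ∧ ∀ i, d.excision i (y.1 0) + 1 ≤ r i y.1}) ⊆ Φ '' {y | τ'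 ≤ y.1 0}) ∧ (∀ i, ∃ T : ℝ, supCkENorm (Subtype.val '' {x : (B i).domain | T ≤ t i x.1 ∧ R₀ ≤ r i x.1 ∧ ∀ j, j ≠ i → r i x.1 ≤ r j x.1}) 0 (𝓢.deviationExtend (B i) (d.chart i)) ≤ ENNReal.ofReal (1 / (10 * ‖(((d.motion i).1 : E4 ≃L[ℝ] E4) : E4 →L[ℝ] E4)‖ ^ 2))) ); ∀ (X : Type) [TopologicalSpace X] [ChartedSpace E3 X] [IsManifold (𝓡 3) ∞ X] [T2Space X] [SecondCountableTopology X] [ConnectedSpace X] (d : InitialDataSet (𝓡 3) X), d ∈ admissibleVacuumData X → (¬ ((∃ 𝒟 : VacuumCauchyDevelopment (d), 𝒟.IsMaximal) ∧ ∀ 𝒟 : VacuumCauchyDevelopment (d), 𝒟.IsMaximal → (HasCompleteNullInfinity 𝒟.toCauchyDevelopment ∧ ∃ (O : Set 𝒟.carrier) (dd : FinalStateDecomposition 𝒟.toSpacetime O 4) (R₀ : ℝ), O = exteriorOf 𝒟.toCauchyDevelopment dd.charted ∧ Hc 𝒟.toSpacetime O 4 dd R₀ ∧ Hf 𝒟.toSpacetime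 O 4 dd R₀ ∧ (∀ i j : Fin dd.N, i ≠ j → ((dd.motion i).1 : E4 ≃L[ℝ] E4) (E4.basisVector 0) ≠ ((dd.motion j).1 : E4 ≃L[ℝ] E4) (E4.basisVector 0)))) → ∃ (e' : AFEnd X) (F' : EuclideanSpace ℝ (Fin 1) → InitialDataSet (𝓡 3) X), InitialDataSet.IsTameDataFamily e' 1 F' ∧ F' 0 = d ∧ Function.Injective F' ∧ InitialDataSet.IsImmersedAtZero 1 F' ∧ (∀ c, F' c ∈ admissibleVacuumData X) ∧ ∃ ε₀ > (0 : ℝ), ∀ c : EuclideanSpace ℝ (Fin 1), c ≠ 0 → ‖c‖ < ε₀ → ((∃ 𝒟 : VacuumCauchyDevelopment (F' c), 𝒟.IsMaximal) ∧ ∀ 𝒟 : VacuumCauchyDevelopment (F' c), 𝒟.IsMaximal → (HasCompleteNullInfinity 𝒟.toCauchyDevelopment ∧ ∃ (O : Set 𝒟.carrier) (dd : FinalStateDecomposition 𝒟.toSpacetime O 4) (R₀ : ℝ), O = exteriorOf 𝒟.toCauchyDevelopment dd.charted ∧ Hc 𝒟.toSpacetime O 4 dd R₀ ∧ Hf 𝒟.toSpacetime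 O 4 dd R₀ ∧ (∀ i j : Fin dd.N, i ≠ j → ((dd.motion i).1 : E4 ≃L[ℝ] E4) (E4.basisVector 0) ≠ ((dd.motion j).1 : E4 ≃L[ℝ] E4) (E4.basisVector 0))))) → ∃ (e' : AFEnd X) (F' : EuclideanSpace ℝ (Fin 1) → InitialDataSet (𝓡 3) X), InitialDataSet.IsTameDataFamily e' 1 F' ∧ F' 0 = d ∧ Function.Injective F' ∧ InitialDataSet.IsImmersedAtZero 1 F' ∧ (∀ c, F' c ∈ admissibleVacuumData X) ∧ ∀ c : EuclideanSpace ℝ (Fin 1), c ≠ 0 → ((∃ 𝒟 : VacuumCauchyDevelopment (F' c), 𝒟.IsMaximal) ∧ ∀ 𝒟 : VacuumCauchyDevelopment (F' c), 𝒟.IsMaximal → (HasCompleteNullInfinity 𝒟.toCauchyDevelopment ∧ ∃ (O : Set 𝒟.carrier) (dd : FinalStateDecomposition 𝒟.toSpacetime O 4) (R₀ : ℝ), O = exteriorOf 𝒟.toCauchyDevelopment dd.charted ∧ Hc 𝒟.toSpacetime O 4 dd R₀ ∧ Hf 𝒟.toSpacetime O 4 dd R₀ ∧ (∀ i j : Fin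 dd.N, i ≠ j → ((dd.motion i).1 : E4 ≃L[ℝ] E4) (E4.basisVector 0) ≠ ((dd.motion j).1 : E4 ≃L[ℝ] E4) (E4.basisVector 0)))) := by
  intro Hc Hf X _ _ _ _ _ _ d hd hkick
  by_cases hP : ((∃ 𝒟 : VacuumCauchyDevelopment (d), 𝒟.IsMaximal) ∧ ∀ 𝒟 : VacuumCauchyDevelopment (d), 𝒟.IsMaximal → (HasCompleteNullInfinity 𝒟.toCauchyDevelopment ∧ ∃ (O : Set 𝒟.carrier) (dd : FinalStateDecomposition 𝒟.toSpacetime O 4) (R₀ : ℝ), O = exteriorOf 𝒟.toCauchyDevelopment dd.charted ∧ Hc 𝒟.toSpacetime O 4 dd R₀ ∧ Hf 𝒟.toSpacetime O 4 dd R₀ ∧ (∀ i j : Fin dd.N, i ≠ j → ((dd.motion i).1 : E4 ≃L[ℝ] E4) (E4.basisVector 0) ≠ ((dd.motion j).1 : E4 ≃L[ℝ] E4) (E4.basisVector 0))))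
  · exact raylessSelfWitness X d hd hP
  · obtain ⟨e', F', hF', h0, hinj, himm, h𝓓', ε₀, hε₀, hP'⟩ := hkick hP
    exact InitialDataSet.exists_tameCurve_of_local
      (P := fun D : InitialDataSet (𝓡 3) X ↦ ((∃ 𝒟 : VacuumCauchyDevelopment D, 𝒟.IsMaximal) ∧ ∀ 𝒟 : VacuumCauchyDevelopment D, 𝒟.IsMaximal → (HasCompleteNullInfinity 𝒟.toCauchyDevelopment ∧ ∃ (O : Set 𝒟.carrier) (dd : FinalStateDecomposition 𝒟.toSpacetime O 4) (R₀ : ℝ), O = exteriorOf 𝒟.toCauchyDevelopment dd.charted ∧ Hc 𝒟.toSpacetime O 4 dd R₀ ∧ Hf 𝒟.toSpacetime O 4 dd R₀ ∧ (∀ i j : Fin dd.N, i ≠ j → ((dd.motion i).1 : E4 ≃L[ℝ] E4) (E4.basisVector 0) ≠ ((dd.motion j).1 : E4 ≃L[ℝ] E4) (E4.basisVector 0)))))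
      hF' h0 hinj himm h𝓓' hε₀ hP'

end Summit.FinalStateConjecture.FinalStateConjecture.Theorems.StarvedNecks.RaylessTransport

end
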